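import Literature.NumberTheory.EllipticCurves.FineSelmerClassGroupPRankBoundedProofs
import Literature.NumberTheory.EllipticCurves.FineSelmerClassGroupCriterion
import Literature.NumberTheory.IwasawaTheory.ClassicalMuVanishesBoundedRankProofs
import HarnessLib

/-!
# Coates–Sujatha 2005, Thm. 3.4 — DISCHARGE of the named fact
# `CoatesSujatha2005.thm34_fineSelmerDual_moduleFinite_of_classicalMuVanishes_divisionField` (proved, no named fact)

`Proofs`-style file (theorems only: no definition, no named fact, no `sorry`) in topic `NumberTheory/EllipticCurves`, namespace
`Literature.NumberTheory.EllipticCurves.CoatesSujatha2005` (that of the named fact, file `FineSelmerClassGroupCriterion`), written by the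
prover seat `bsd-potss-k8t-c4` g22 (cell `bsd-potss`, K8-t′ route, item stmt-BirchSwinnertonDyer-19982; closes nothing).

THE DISCHARGE. The named fact (Coates–Sujatha, Math. Ann. 331 (2005) Thm. 3.4, as restated by Kurihara–Pollack 2007 §3.1 and Ray–Sujatha 2021
Thm. 2.3): for `E/ℚ` and `p` odd, if every cyclotomic `ℤ_p`-extension of `ℚ(E[p])` has Iwasawa's `μ = 0` in GROWTH FORM
(`ClassicalMuVanishes`: `ord_p h(L_n) = λ n + ν` for `n ≫ 0`), then statement (A) holds for `E` at `p` (the dual fine Selmer group over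
`ℚ_∞` is finitely generated over `ℤ_p`).  Proof = two tree theorems: growth-form `μ = 0` ⟹ BOUNDED `p`-ranks along the tower
(`IwasawaTheory.exists_forall_classGroupPRank_le_of_classicalMuVanishes`, g22, finite level, no structure theory) and the bounded-rank form of
Thm. 3.4 (`fineSelmerDual_moduleFinite_of_classGroupPRank_le`, g21: inflation–restriction to the trivialising tower, extension of
locally-trivial homomorphisms to a finite layer, the class-field-theoretic count).  Stated for every number field `K` first
(`fineSelmerDual_moduleFinite_of_classicalMuVanishes`), then the `_holds` theorem VERBATIM.

Honest framing: this proves the IMPLICATION «`μ_class(ℚ(E[p])_cyc) = 0` ⟹ (A)»; it proves `μ = 0` for no field and (A) for no curve.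

References: [CoatesSujatha2005] Thm. 3.4; [KuriharaPollack2007] §3.1; [RaySujatha2021] Thm. 2.3; [Washington1997] §13.3 Prop. 13.23.
-/

set_option autoImplicit false

noncomputable section

open scoped Classical NumberField
open NumberField Field IntermediateField

namespace Literature.NumberTheory.EllipticCurves.CoatesSujatha2005

open WeierstrassCurve Literature.NumberTheory.IwasawaTheory Literature.NumberTheory.EllipticCurves
  Literature.NumberTheory.EllipticCurves.ZpExtension

/-- **Coates–Sujatha Thm. 3.4 over a number field, growth form.** For `E = W` elliptic over a number field `K`, `p` odd, `κ` the cyclotomic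
`ℤ_p`-extension of `K`: if some cyclotomic `ℤ_p`-extension of `L = K(E[p])` has `μ = 0` in growth form (`ClassicalMuVanishes`), then the dual
fine Selmer group of `E` over `K_∞` is finitely generated over `ℤ_p` (statement (A)).
[cite: CoatesSujatha2005, Thm. 3.4] [cite: RaySujatha2021, Thm. 2.3] [cite: KuriharaPollack2007, §3.1] -/
theorem fineSelmerDual_moduleFinite_of_classicalMuVanishes {K : Type} [Field K] [NumberField K] (W : WeierstrassCurve K) [W.IsElliptic]
    {p : ℕ} [Fact p.Prime] (hp : p ≠ 2) (κ : ZpExtension K p) (hκ : κ.IsCyclotomic)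
    (hμ : haveI : NeZero p := ⟨(Fact.out : p.Prime).ne_zero⟩
      ∃ κL : ZpExtension ↥(W.divisionField p) p, κL.IsCyclotomic ∧ ClassicalMuVanishes κL) :
    ∃ (γ : absoluteGaloisGroup K) (D : W.FineSelmerDualData κ γ),
      Module.Finite ℤ_[p] (RestrictScalars ℤ_[p] (IwasawaAlgebra p) D.X) := by
  haveI : NeZero p := ⟨(Fact.out : p.Prime).ne_zero⟩
  haveI : NumberField (W.divisionField p) := NumberField.of_module_finite K _
  obtain ⟨κL, hκL, hμL⟩ := hμ
  obtain ⟨B, hB⟩ := exists_forall_classGroupPRank_le_of_classicalMuVanishes κL hμL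
  exact fineSelmerDual_moduleFinite_of_classGroupPRank_le W hp κ hκ B ⟨κL, hκL, hB⟩

/-- **DISCHARGE of `thm34_fineSelmerDual_moduleFinite_of_classicalMuVanishes_divisionField`** (Coates–Sujatha 2005 Thm. 3.4 for `E/ℚ`, `p` odd:
`ClassicalMuVanishes` for every cyclotomic `ℤ_p`-extension of `ℚ(E[p])` ⟹ statement (A) over `ℚ_∞`) — VERBATIM the named fact, from
`fineSelmerDual_moduleFinite_of_classicalMuVanishes` at the shifted base change of `κ` to `ℚ(E[p])` (`exists_zpExtension_shift`, cyclotomic).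
[cite: CoatesSujatha2005, Thm. 3.4] [cite: KuriharaPollack2007, §3.1] [cite: RaySujatha2021, Thm. 2.3] -/
theorem thm34_fineSelmerDual_moduleFinite_of_classicalMuVanishes_divisionField_holds :
    thm34_fineSelmerDual_moduleFinite_of_classicalMuVanishes_divisionField := by
  intro W _ p _ hp hμ κ hκ
  haveI : NeZero p := ⟨(Fact.out : p.Prime).ne_zero⟩
  haveI : NumberField (W.divisionField p) := NumberField.of_module_finite ℚ _
  obtain ⟨a, κ', hs⟩ := exists_zpExtension_shift κ ↥(W.divisionField p)
  have hκ' : κ'.IsCyclotomic := isCyclotomic_of_shift κ _ κ' hs hκ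
  exact fineSelmerDual_moduleFinite_of_classicalMuVanishes W hp κ hκ ⟨κ', hκ', hμ κ' hκ'⟩

/-- **Coates–Sujatha Thm. 3.4 over a number field, LINEAR-UPPER-BOUND form** (the input the μ-descent roads deliver without Iwasawa's
growth theorem): if some cyclotomic `ℤ_p`-extension of `L = K(E[p])` has `ord_p h(L_n) ≤ a·n + b` for `n ≥ n₁`, then statement (A) holds
for `E` at the odd prime `p` over `K_∞` (`exists_forall_classGroupPRank_le_of_classNumberPExp_le_linear` ∘ g21's bounded-rank form).
[cite: CoatesSujatha2005, Thm. 3.4] [cite: RaySujatha2021, Thm. 2.3] [cite: Washington1997, §13.3 Prop. 13.23] -/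
theorem fineSelmerDual_moduleFinite_of_classNumberPExp_le_linear {K : Type} [Field K] [NumberField K] (W : WeierstrassCurve K)
    [W.IsElliptic] {p : ℕ} [Fact p.Prime] (hp : p ≠ 2) (κ : ZpExtension K p) (hκ : κ.IsCyclotomic)
    (hle : haveI : NeZero p := ⟨(Fact.out : p.Prime).ne_zero⟩
      ∃ κL : ZpExtension ↥(W.divisionField p) p, κL.IsCyclotomic ∧
        ∃ a b n₁ : ℕ, ∀ n, n₁ ≤ n → classNumberPExp κL n ≤ a * n + b) :
    ∃ (γ : absoluteGaloisGroup K) (D : W.FineSelmerDualData κ γ),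
      Module.Finite ℤ_[p] (RestrictScalars ℤ_[p] (IwasawaAlgebra p) D.X) := by
  haveI : NeZero p := ⟨(Fact.out : p.Prime).ne_zero⟩
  haveI : NumberField (W.divisionField p) := NumberField.of_module_finite K _
  obtain ⟨κL, hκL, a, b, n₁, hleL⟩ := hle
  obtain ⟨B, hB⟩ := exists_forall_classGroupPRank_le_of_classNumberPExp_le_linear κL hleL
  exact fineSelmerDual_moduleFinite_of_classGroupPRank_le W hp κ hκ B ⟨κL, hκL, hB⟩

end Literature.NumberTheory.EllipticCurves.CoatesSujatha2005

end
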